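import Summits.CriticalPhenomena.PercolationContinuityZ3.Theorems.Transplant.FKConnectivityAllQAntipodalOrAttInputs
import HarnessLib

/-!
# Connectivity correlation inequalities for `φ_{w,q}`, every `q > 0` — file 63e₀: the INDUCTION STEP INPUTS of the AND-attached OR drift theorem — the rootless, virtual-root and
# root-contracted drift-triples of a smaller network from the induction hypothesis

Support file (`--supports stmt-CriticalPhenomena-4575`), FK sub-lane `prim-bschramm-fk-2` (gen 29; the `A ⊇ C` version of gen 22's file 47e
`…OrAttPath`, memo FROM-fk-2-g29-BRIDGE §11); builds on p205010 (kernel theorem, internal audit signed; external expert review pending).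
No definitions, no named facts, no sorries; standard axioms.

The AND-attached OR drift `O_A(N; y, z; C) = D(yzA | C) + D(zA | yC) + D(yA | zC)` (`C ⊆ A`, `A` attached on the root side; module docstring of
`…OrAttTPath`) is proved by strong induction on the size of the network.  This file derives, from the induction hypothesis at size `n` (an explicit
`∀`-hypothesis `ih`), the three forms of the drift-triple of a network `F` of size `≤ n` that the junction lemmas consume:
* `FK.orAttT_rootless_of_ih` — (R) the ROOTLESS triple with attached set `A ⊆ F ∪ {uv}`: gen 22's `FK.orAttW_rootless_nonpos` when `A = C`, otherwise
  the ROOTED triple of the host `F ∪ {uv}` re-rooted at an attached edge `e ∈ A ∖ C` (`IsTTSP.reroot_erase`, as in `FK.andGenW_rootless_nonpos_of_isTTSP`);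
* `FK.orAttT_virt_of_ih` — (V) the triple with a VIRTUAL root `uv` (possibly an edge of `F`): root outside ⇒ `ih`; root `= y` / `= z` ⇒ pairing lemma +
  two rootless AND drifts with a general attached set; root attached ⇒ (R); root free ⇒ doubled-root decomposition of each drift
  (`FK.twoSidedW_doubled_eq`) ⇒ `ih` on `F ∖ uv` + (R) with `uv` inserted on both sides; root deleted ⇒ `ih`;
* `FK.orAttT_contracted_of_ih` — (K) the triple with the root CONTRACTED (inserted on both sides), from (R).
[cite: Grimmett2006, §1.4 eq. (1.20) (p. 15); §3.8 Thm. (3.90) (pp. 61–62); §3.9 (pp. 63–64)] [cite: Wagner2006, Thm. 5.8(d), §5.3]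
-/

noncomputable section

namespace Summit.CriticalPhenomena.PercolationContinuityZ3.Theorems

namespace FK

open SimpleGraph Literature.Probability.LatticeModels Literature.Probability.Percolation
open scoped Classical

variable {V : Type*} [Fintype V]

section OrAttTStep

omit [Fintype V] in
/-- Cardinality bookkeeping for re-rooting: `|(insert e F).erase f| ≤ |F|` when `f ∈ insert e F`. [folklore] -/
theorem card_insert_erase_le (F : Finset (Sym2 V)) (e f : Sym2 V) (hf : f ∈ insert e F) : ((insert e F).erase f).card ≤ F.card := by
  have h1 := Finset.card_erase_of_mem hf
  have h2 := Finset.card_insert_le e F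
  omega

/-- **(R) The ROOTLESS drift-triple** of a network of size `≤ n` with attached set `A ⊆ F ∪ {uv}`, from the induction hypothesis at size `n`: gen 22's rootless lemma when `A = C`, otherwise the host `F ∪ {uv}` re-rooted at an attached edge `e ∈ A \\ C` (`IsTTSP.reroot_erase`). [cite: Grimmett2006, §3.8 Thm. (3.90) (pp. 61–62)] -/
theorem orAttT_rootless_of_ih {n : ℕ}
    (ih : ∀ {E : Finset (Sym2 V)} {s t : V} {N A C : Finset (Sym2 V)} {y z : Sym2 V}, E.card ≤ n → IsTTSP E s t → s(s, t) ∉ E →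
      N ⊆ E → A ⊆ E → C ⊆ A → y ∈ E → z ∈ E → y ≠ z → y ∉ N → z ∉ N → y ∉ A → z ∉ A → Disjoint N A →
      ∀ w : ℕ → ℝ, (∀ k : ℕ, w (k + 1) ≤ w k) →
      ∀ h : Finset (Sym2 V) → ℝ, (∀ ⦃X Y : Finset (Sym2 V)⦄, X ⊆ Y → Y ⊆ N → h X ≤ h Y) →
        ∑ γ ∈ N.powerset,
          ((w (clusterCount (↑(insert s(s, t) (γ ∪ insert y (insert z A))) : BondConfig V) ∅ + clusterCount (↑(N \ γ ∪ C) : BondConfig V) ∅) -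
            w (clusterCount (↑(insert s(s, t) (N \ γ ∪ insert y (insert z A))) : BondConfig V) ∅ + clusterCount (↑(γ ∪ C) : BondConfig V) ∅)) * h γ) +
        ∑ γ ∈ N.powerset,
          ((w (clusterCount (↑(insert s(s, t) (γ ∪ insert z A)) : BondConfig V) ∅ + clusterCount (↑(N \ γ ∪ insert y C) : BondConfig V) ∅) -
            w (clusterCount (↑(insert s(s, t) (N \ γ ∪ insert z A)) : BondConfig V) ∅ + clusterCount (↑(γ ∪ insert y C) : BondConfig V) ∅)) * h γ) +
        ∑ γ ∈ N.powerset,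
          ((w (clusterCount (↑(insert s(s, t) (γ ∪ insert y A)) : BondConfig V) ∅ + clusterCount (↑(N \ γ ∪ insert z C) : BondConfig V) ∅) -
            w (clusterCount (↑(insert s(s, t) (N \ γ ∪ insert y A)) : BondConfig V) ∅ + clusterCount (↑(γ ∪ insert z C) : BondConfig V) ∅)) * h γ) ≤ 0) :
    ∀ {F : Finset (Sym2 V)} {u v : V} {N A C : Finset (Sym2 V)} {y z : Sym2 V}, F.card ≤ n → IsTTSP F u v →
    N ⊆ F → A ⊆ insert s(u, v) F → C ⊆ A → y ∈ insert s(u, v) F → z ∈ insert s(u, v) F → y ≠ z → y ∉ N → z ∉ N → y ∉ A → z ∉ A →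
    Disjoint N A → ∀ w : ℕ → ℝ, (∀ k : ℕ, w (k + 1) ≤ w k) →
    ∀ h : Finset (Sym2 V) → ℝ, (∀ ⦃X Y : Finset (Sym2 V)⦄, X ⊆ Y → Y ⊆ N → h X ≤ h Y) →
      ∑ γ ∈ N.powerset,
      ((w (clusterCount (↑(γ ∪ insert y (insert z A)) : BondConfig V) ∅ + clusterCount (↑(N \ γ ∪ C) : BondConfig V) ∅) -
        w (clusterCount (↑(N \ γ ∪ insert y (insert z A)) : BondConfig V) ∅ + clusterCount (↑(γ ∪ C) : BondConfig V) ∅)) * h γ) +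
    ∑ γ ∈ N.powerset,
      ((w (clusterCount (↑(γ ∪ insert z A) : BondConfig V) ∅ + clusterCount (↑(N \ γ ∪ insert y C) : BondConfig V) ∅) -
        w (clusterCount (↑(N \ γ ∪ insert z A) : BondConfig V) ∅ + clusterCount (↑(γ ∪ insert y C) : BondConfig V) ∅)) * h γ) +
    ∑ γ ∈ N.powerset,
      ((w (clusterCount (↑(γ ∪ insert y A) : BondConfig V) ∅ + clusterCount (↑(N \ γ ∪ insert z C) : BondConfig V) ∅) -
        w (clusterCount (↑(N \ γ ∪ insert y A) : BondConfig V) ∅ + clusterCount (↑(γ ∪ insert z C) : BondConfig V) ∅)) * h γ) ≤ 0 := by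
  intro F u v N A C y z hF hFT hN hA hCA hy hz hyz hyN hzN hyA hzA hNA w hw h hm
  by_cases hAC : A = C
  · subst hAC
    exact orAttW_rootless_nonpos hFT hN hA hy hz hyN hzN hNA hw hm
  · obtain ⟨e, he⟩ : (A \ C).Nonempty := by
      rw [Finset.nonempty_iff_ne_empty, Ne, Finset.sdiff_eq_empty_iff_subset]
      exact fun hh => hAC (le_antisymm hh hCA)
    revert he
    refine Sym2.ind (fun a b => ?_) e
    intro he
    have heA : s(a, b) ∈ A := (Finset.mem_sdiff.1 he).1
    have heC : s(a, b) ∉ C := (Finset.mem_sdiff.1 he).2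
    have heF : s(a, b) ∈ insert s(u, v) F := hA heA
    have hne : insert s(u, v) F ≠ {s(a, b)} := by
      intro hh
      have hy' : y ∈ ({s(a, b)} : Finset (Sym2 V)) := hh ▸ hy
      rw [Finset.mem_singleton] at hy'
      exact hyA (hy' ▸ heA)
    have hE' : IsTTSP ((insert s(u, v) F).erase s(a, b)) a b := hFT.reroot_erase heF hne
    have hcard' : ((insert s(u, v) F).erase s(a, b)).card ≤ n := (card_insert_erase_le F _ _ heF).trans hF
    have key := ih hcard' hE' (Finset.notMem_erase _ _) (N := N) (A := A.erase s(a, b)) (C := C) (y := y) (z := z)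
      (fun f hf => Finset.mem_erase.2 ⟨fun hh => Finset.disjoint_left.1 hNA hf (hh ▸ heA), Finset.mem_insert_of_mem (hN hf)⟩)
      (fun f hf => Finset.mem_erase.2 ⟨(Finset.mem_erase.1 hf).1, hA (Finset.mem_of_mem_erase hf)⟩)
      (fun f hf => Finset.mem_erase.2 ⟨fun hh => heC (hh ▸ hf), hCA hf⟩)
      (Finset.mem_erase.2 ⟨fun hh => hyA (hh ▸ heA), hy⟩) (Finset.mem_erase.2 ⟨fun hh => hzA (hh ▸ heA), hz⟩) hyz hyN hzN
      (fun hh => hyA (Finset.mem_of_mem_erase hh)) (fun hh => hzA (Finset.mem_of_mem_erase hh))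
      (Finset.disjoint_of_subset_right (Finset.erase_subset _ _) hNA) w hw h hm
    have e1 : ∀ X : Finset (Sym2 V), insert s(a, b) (X ∪ insert y (insert z (A.erase s(a, b)))) = X ∪ insert y (insert z A) := fun X => by
      rw [← Finset.union_insert, Finset.insert_comm (s(a, b)) y, Finset.insert_comm (s(a, b)) z, Finset.insert_erase heA]
    have e2 : ∀ X : Finset (Sym2 V), insert s(a, b) (X ∪ insert z (A.erase s(a, b))) = X ∪ insert z A := fun X => by
      rw [← Finset.union_insert, Finset.insert_comm (s(a, b)) z, Finset.insert_erase heA]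
    have e3 : ∀ X : Finset (Sym2 V), insert s(a, b) (X ∪ insert y (A.erase s(a, b))) = X ∪ insert y A := fun X => by
      rw [← Finset.union_insert, Finset.insert_comm (s(a, b)) y, Finset.insert_erase heA]
    simp_rw [e1, e2, e3] at key
    exact key

/-- **(V) The drift-triple with a VIRTUAL root** `uv` (possibly an edge of the network) of a network of size `≤ n`, from the induction hypothesis: root outside ⇒ IH; root `= y` / `= z` ⇒ pairing lemma + two rootless AND drifts; root attached ⇒ (R); root free ⇒ doubled root; root deleted ⇒ IH. [cite: Grimmett2006, §3.8 Thm. (3.90) (pp. 61–62)] -/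
theorem orAttT_virt_of_ih {n : ℕ}
    (ih : ∀ {E : Finset (Sym2 V)} {s t : V} {N A C : Finset (Sym2 V)} {y z : Sym2 V}, E.card ≤ n → IsTTSP E s t → s(s, t) ∉ E →
      N ⊆ E → A ⊆ E → C ⊆ A → y ∈ E → z ∈ E → y ≠ z → y ∉ N → z ∉ N → y ∉ A → z ∉ A → Disjoint N A →
      ∀ w : ℕ → ℝ, (∀ k : ℕ, w (k + 1) ≤ w k) →
      ∀ h : Finset (Sym2 V) → ℝ, (∀ ⦃X Y : Finset (Sym2 V)⦄, X ⊆ Y → Y ⊆ N → h X ≤ h Y) →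
        ∑ γ ∈ N.powerset,
          ((w (clusterCount (↑(insert s(s, t) (γ ∪ insert y (insert z A))) : BondConfig V) ∅ + clusterCount (↑(N \ γ ∪ C) : BondConfig V) ∅) -
            w (clusterCount (↑(insert s(s, t) (N \ γ ∪ insert y (insert z A))) : BondConfig V) ∅ + clusterCount (↑(γ ∪ C) : BondConfig V) ∅)) * h γ) +
        ∑ γ ∈ N.powerset,
          ((w (clusterCount (↑(insert s(s, t) (γ ∪ insert z A)) : BondConfig V) ∅ + clusterCount (↑(N \ γ ∪ insert y C) : BondConfig V) ∅) -
            w (clusterCount (↑(insert s(s, t) (N \ γ ∪ insert z A)) : BondConfig V) ∅ + clusterCount (↑(γ ∪ insert y C) : BondConfig V) ∅)) * h γ) +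
        ∑ γ ∈ N.powerset,
          ((w (clusterCount (↑(insert s(s, t) (γ ∪ insert y A)) : BondConfig V) ∅ + clusterCount (↑(N \ γ ∪ insert z C) : BondConfig V) ∅) -
            w (clusterCount (↑(insert s(s, t) (N \ γ ∪ insert y A)) : BondConfig V) ∅ + clusterCount (↑(γ ∪ insert z C) : BondConfig V) ∅)) * h γ) ≤ 0) :
    ∀ {F : Finset (Sym2 V)} {u v : V} {N A C : Finset (Sym2 V)} {y z : Sym2 V}, F.card ≤ n → IsTTSP F u v →
    N ⊆ F → A ⊆ F → C ⊆ A → y ∈ F → z ∈ F → y ≠ z → y ∉ N → z ∉ N → y ∉ A → z ∉ A → Disjoint N A →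
    ∀ w : ℕ → ℝ, (∀ k : ℕ, w (k + 1) ≤ w k) →
    ∀ h : Finset (Sym2 V) → ℝ, (∀ ⦃X Y : Finset (Sym2 V)⦄, X ⊆ Y → Y ⊆ N → h X ≤ h Y) →
      ∑ γ ∈ N.powerset,
      ((w (clusterCount (↑(insert s(u, v) (γ ∪ insert y (insert z A))) : BondConfig V) ∅ + clusterCount (↑(N \ γ ∪ C) : BondConfig V) ∅) -
        w (clusterCount (↑(insert s(u, v) (N \ γ ∪ insert y (insert z A))) : BondConfig V) ∅ + clusterCount (↑(γ ∪ C) : BondConfig V) ∅)) * h γ) +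
    ∑ γ ∈ N.powerset,
      ((w (clusterCount (↑(insert s(u, v) (γ ∪ insert z A)) : BondConfig V) ∅ + clusterCount (↑(N \ γ ∪ insert y C) : BondConfig V) ∅) -
        w (clusterCount (↑(insert s(u, v) (N \ γ ∪ insert z A)) : BondConfig V) ∅ + clusterCount (↑(γ ∪ insert y C) : BondConfig V) ∅)) * h γ) +
    ∑ γ ∈ N.powerset,
      ((w (clusterCount (↑(insert s(u, v) (γ ∪ insert y A)) : BondConfig V) ∅ + clusterCount (↑(N \ γ ∪ insert z C) : BondConfig V) ∅) -
        w (clusterCount (↑(insert s(u, v) (N \ γ ∪ insert y A)) : BondConfig V) ∅ + clusterCount (↑(γ ∪ insert z C) : BondConfig V) ∅)) * h γ) ≤ 0 := by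
  intro F u v N A C y z hF hFT hN hA hCA hy hz hyz hyN hzN hyA hzA hNA w hw h hm
  have hyC : y ∉ C := fun hh => hyA (hCA hh)
  have hzC : z ∉ C := fun hh => hzA (hCA hh)
  by_cases huvF : s(u, v) ∈ F
  swap
  · exact ih hF hFT huvF hN hA hCA hy hz hyz hyN hzN hyA hzA hNA w hw h hm
  have hAF : A ⊆ insert s(u, v) F := hA.trans (Finset.subset_insert _ _)
  by_cases huvy : s(u, v) = y
  · -- root = y: (yzA|C) + (yA|zC) pair into the rootless drift of `N ∪ {z}` with `(yA | C)`; (zA|yC) becomes rootless `(yzA | yC)`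
    subst huvy
    have e1 : ∀ X : Finset (Sym2 V), insert s(u, v) (X ∪ insert s(u, v) (insert z A)) = X ∪ insert z (insert s(u, v) A) := fun X => by
      simp only [Finset.union_insert, Finset.insert_idem]; exact Finset.insert_comm _ _ _
    have e2 : ∀ X : Finset (Sym2 V), insert s(u, v) (X ∪ insert z A) = X ∪ insert s(u, v) (insert z A) := fun X =>
      (Finset.union_insert _ _ _).symm
    have e3 : ∀ X : Finset (Sym2 V), insert s(u, v) (X ∪ insert s(u, v) A) = X ∪ insert s(u, v) A := fun X => by
      simp only [Finset.union_insert, Finset.insert_idem]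
    simp_rw [e1, e2, e3]
    have pair := twoSidedW_pair_insert_rootless_eq w (insert s(u, v) A) C hzN h
    have i₁ := andGenW_rootless_nonpos_of_isTTSP hFT (N := insert z N) (A := insert s(u, v) A) (C := C)
      (Finset.insert_subset hz hN) (Finset.insert_subset_insert _ hA) (hCA.trans (Finset.subset_insert _ _))
      (Finset.disjoint_insert_left.2 ⟨by
        rw [Finset.mem_insert, not_or]; exact ⟨fun hh => hyz hh.symm, hzA⟩,
        Finset.disjoint_insert_right.2 ⟨hyN, hNA⟩⟩) hw
      (h := fun γ => h (γ.erase z)) (fun X Y hXY hY => hm (Finset.erase_subset_erase _ hXY) (by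
        intro e he
        have he' := hY (Finset.mem_of_mem_erase he)
        rcases Finset.mem_insert.1 he' with h' | h'
        · exact absurd h' (Finset.ne_of_mem_erase he)
        · exact h'))
    have i₂ := andGenW_rootless_nonpos_of_isTTSP hFT hN (A := insert s(u, v) (insert z A)) (C := insert s(u, v) C)
      (Finset.insert_subset (Finset.mem_insert_self _ _) (Finset.insert_subset (Finset.mem_insert_of_mem hz) hAF))
      (Finset.insert_subset_insert _ (hCA.trans (Finset.subset_insert _ _)))
      (Finset.disjoint_insert_right.2 ⟨hyN, Finset.disjoint_insert_right.2 ⟨hzN, hNA⟩⟩) hw hm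
    rw [pair.symm] at i₁
    linarith
  by_cases huvz : s(u, v) = z
  · -- root = z: (yzA|C) + (zA|yC) pair into the rootless drift of `N ∪ {y}` with `(zA | C)`; (yA|zC) becomes rootless `(yzA | zC)`
    subst huvz
    have e1 : ∀ X : Finset (Sym2 V), insert s(u, v) (X ∪ insert y (insert s(u, v) A)) = X ∪ insert y (insert s(u, v) A) := fun X => by
      simp only [Finset.union_insert]; rw [Finset.insert_comm (s(u, v)) y, Finset.insert_idem]
    have e2 : ∀ X : Finset (Sym2 V), insert s(u, v) (X ∪ insert s(u, v) A) = X ∪ insert s(u, v) A := fun X => by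
      simp only [Finset.union_insert, Finset.insert_idem]
    have e3 : ∀ X : Finset (Sym2 V), insert s(u, v) (X ∪ insert y A) = X ∪ insert y (insert s(u, v) A) := fun X => by
      simp only [Finset.union_insert]; exact Finset.insert_comm _ _ _
    simp_rw [e1, e2, e3]
    have pair := twoSidedW_pair_insert_rootless_eq w (insert s(u, v) A) C hyN h
    have i₁ := andGenW_rootless_nonpos_of_isTTSP hFT (N := insert y N) (A := insert s(u, v) A) (C := C)
      (Finset.insert_subset hy hN) (Finset.insert_subset_insert _ hA) (hCA.trans (Finset.subset_insert _ _))
      (Finset.disjoint_insert_left.2 ⟨by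
        rw [Finset.mem_insert, not_or]; exact ⟨hyz, hyA⟩,
        Finset.disjoint_insert_right.2 ⟨hzN, hNA⟩⟩) hw
      (h := fun γ => h (γ.erase y)) (fun X Y hXY hY => hm (Finset.erase_subset_erase _ hXY) (by
        intro e he
        have he' := hY (Finset.mem_of_mem_erase he)
        rcases Finset.mem_insert.1 he' with h' | h'
        · exact absurd h' (Finset.ne_of_mem_erase he)
        · exact h'))
    have i₂ := andGenW_rootless_nonpos_of_isTTSP hFT hN (A := insert y (insert s(u, v) A)) (C := insert s(u, v) C)
      (Finset.insert_subset (Finset.mem_insert_of_mem hy) (Finset.insert_subset (Finset.mem_insert_self _ _) hAF))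
      (Finset.insert_subset_insert _ hCA |>.trans (Finset.subset_insert _ _))
      (Finset.disjoint_insert_right.2 ⟨hyN, Finset.disjoint_insert_right.2 ⟨hzN, hNA⟩⟩) hw hm
    rw [pair.symm] at i₁
    linarith
  by_cases huvA : s(u, v) ∈ A
  · -- root attached: everything is rootless
    have hins : ∀ X Y : Finset (Sym2 V), A ⊆ Y → insert s(u, v) (X ∪ Y) = X ∪ Y := fun X Y hY =>
      Finset.insert_eq_of_mem (Finset.mem_union_right _ (hY huvA))
    have sA : A ⊆ insert y (insert z A) := (Finset.subset_insert _ _).trans (Finset.subset_insert _ _)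
    simp_rw [hins _ _ sA, hins _ _ (Finset.subset_insert z A), hins _ _ (Finset.subset_insert y A)]
    exact orAttT_rootless_of_ih ih hF hFT hN hAF hCA (Finset.mem_insert_of_mem hy) (Finset.mem_insert_of_mem hz) hyz hyN hzN hyA hzA hNA w hw h hm
  have huvC : s(u, v) ∉ C := fun hh => huvA (hCA hh)
  have hF1 : F ≠ {s(u, v)} := fun hh => huvy (by
    have := hy; rw [hh, Finset.mem_singleton] at this; exact this.symm)
  have hE' : IsTTSP (F.erase s(u, v)) u v := hFT.erase_terminal_edge huvF hF1
  have hcard' : (F.erase s(u, v)).card ≤ n := (Finset.card_erase_le).trans hF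
  have hyF' : y ∈ F.erase s(u, v) := Finset.mem_erase.2 ⟨fun hh => huvy hh.symm, hy⟩
  have hzF' : z ∈ F.erase s(u, v) := Finset.mem_erase.2 ⟨fun hh => huvz hh.symm, hz⟩
  have hAF' : A ⊆ F.erase s(u, v) := fun f hf => Finset.mem_erase.2 ⟨fun hh => huvA (hh ▸ hf), hA hf⟩
  by_cases huvN : s(u, v) ∈ N
  · -- root free: the doubled root, drift by drift
    rw [twoSidedW_doubled_eq w (insert y (insert z A)) C huvN h, twoSidedW_doubled_eq w (insert z A) (insert y C) huvN h,
      twoSidedW_doubled_eq w (insert y A) (insert z C) huvN h]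
    have r₁ := twoSidedW_doubled_rem_nonpos hw (insert y (insert z A)) C huvN hm
    have r₂ := twoSidedW_doubled_rem_nonpos hw (insert z A) (insert y C) huvN hm
    have r₃ := twoSidedW_doubled_rem_nonpos hw (insert y A) (insert z C) huvN hm
    have hN'N : N.erase s(u, v) ⊆ N := Finset.erase_subset _ _
    -- the recursive part: IH on `F \ uv` against `h(· ∪ uv)`
    have hrec := ih hcard' hE' (Finset.notMem_erase _ _) (Finset.erase_subset_erase _ hN) hAF' hCA hyF' hzF' hyz
      (fun hh => hyN (hN'N hh)) (fun hh => hzN (hN'N hh)) hyA hzA (Finset.disjoint_of_subset_left hN'N hNA) w hw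
      (fun γ => h (insert s(u, v) γ)) (fun X Y hXY hY =>
        hm (Finset.insert_subset_insert _ hXY) (Finset.insert_subset huvN (hY.trans hN'N)))
    -- the contracted part: rootless, `uv` inserted on both sides
    have con := orAttT_rootless_of_ih ih hF hFT (hN'N.trans hN) (A := insert s(u, v) A) (C := insert s(u, v) C)
      (Finset.insert_subset_insert _ hA) (Finset.insert_subset_insert _ hCA)
      (Finset.mem_insert_of_mem hy) (Finset.mem_insert_of_mem hz) hyz (fun hh => hyN (hN'N hh)) (fun hh => hzN (hN'N hh))
      (by rw [Finset.mem_insert, not_or]; exact ⟨fun hh => huvy hh.symm, hyA⟩)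
      (by rw [Finset.mem_insert, not_or]; exact ⟨fun hh => huvz hh.symm, hzA⟩)
      (Finset.disjoint_insert_right.2 ⟨Finset.notMem_erase _ _, Finset.disjoint_of_subset_left hN'N hNA⟩) w hw
      h (fun X Y hXY hY => hm hXY (hY.trans hN'N))
    have e1 : ∀ X : Finset (Sym2 V), X ∪ insert y (insert z (insert s(u, v) A)) = insert s(u, v) (X ∪ insert y (insert z A)) :=
      fun X => by simp only [Finset.union_insert]; rw [Finset.insert_comm (s(u, v)) y, Finset.insert_comm (s(u, v)) z]
    have e2 : ∀ X : Finset (Sym2 V), X ∪ insert z (insert s(u, v) A) = insert s(u, v) (X ∪ insert z A) := fun X => by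
      simp only [Finset.union_insert]; exact Finset.insert_comm _ _ _
    have e3 : ∀ X : Finset (Sym2 V), X ∪ insert y (insert s(u, v) A) = insert s(u, v) (X ∪ insert y A) := fun X => by
      simp only [Finset.union_insert]; exact Finset.insert_comm _ _ _
    have e4 : ∀ X : Finset (Sym2 V), X ∪ insert s(u, v) C = insert s(u, v) (X ∪ C) := fun X => Finset.union_insert _ _ _
    have e5 : ∀ X : Finset (Sym2 V), X ∪ insert y (insert s(u, v) C) = insert s(u, v) (X ∪ insert y C) := fun X => by
      simp only [Finset.union_insert]; exact Finset.insert_comm _ _ _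
    have e6 : ∀ X : Finset (Sym2 V), X ∪ insert z (insert s(u, v) C) = insert s(u, v) (X ∪ insert z C) := fun X => by
      simp only [Finset.union_insert]; exact Finset.insert_comm _ _ _
    simp_rw [e1, e2, e3, e4, e5, e6] at con
    linarith
  · -- root deleted: IH on `F \ uv`
    exact ih hcard' hE' (Finset.notMem_erase _ _) (fun f hf => Finset.mem_erase.2 ⟨fun hh => huvN (hh ▸ hf), hN hf⟩) hAF' hCA
      hyF' hzF' hyz hyN hzN hyA hzA hNA w hw h hm

/-- **(K) The drift-triple with the root CONTRACTED** (inserted on both sides) for a network of size `≤ n` avoiding the root, from (R). [cite: Grimmett2006, §3.8 Thm. (3.90) (pp. 61–62)] -/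
theorem orAttT_contracted_of_ih {n : ℕ}
    (ih : ∀ {E : Finset (Sym2 V)} {s t : V} {N A C : Finset (Sym2 V)} {y z : Sym2 V}, E.card ≤ n → IsTTSP E s t → s(s, t) ∉ E →
      N ⊆ E → A ⊆ E → C ⊆ A → y ∈ E → z ∈ E → y ≠ z → y ∉ N → z ∉ N → y ∉ A → z ∉ A → Disjoint N A →
      ∀ w : ℕ → ℝ, (∀ k : ℕ, w (k + 1) ≤ w k) →
      ∀ h : Finset (Sym2 V) → ℝ, (∀ ⦃X Y : Finset (Sym2 V)⦄, X ⊆ Y → Y ⊆ N → h X ≤ h Y) →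
        ∑ γ ∈ N.powerset,
          ((w (clusterCount (↑(insert s(s, t) (γ ∪ insert y (insert z A))) : BondConfig V) ∅ + clusterCount (↑(N \ γ ∪ C) : BondConfig V) ∅) -
            w (clusterCount (↑(insert s(s, t) (N \ γ ∪ insert y (insert z A))) : BondConfig V) ∅ + clusterCount (↑(γ ∪ C) : BondConfig V) ∅)) * h γ) +
        ∑ γ ∈ N.powerset,
          ((w (clusterCount (↑(insert s(s, t) (γ ∪ insert z A)) : BondConfig V) ∅ + clusterCount (↑(N \ γ ∪ insert y C) : BondConfig V) ∅) -
            w (clusterCount (↑(insert s(s, t) (N \ γ ∪ insert z A)) : BondConfig V) ∅ + clusterCount (↑(γ ∪ insert y C) : BondConfig V) ∅)) * h γ) +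
        ∑ γ ∈ N.powerset,
          ((w (clusterCount (↑(insert s(s, t) (γ ∪ insert y A)) : BondConfig V) ∅ + clusterCount (↑(N \ γ ∪ insert z C) : BondConfig V) ∅) -
            w (clusterCount (↑(insert s(s, t) (N \ γ ∪ insert y A)) : BondConfig V) ∅ + clusterCount (↑(γ ∪ insert z C) : BondConfig V) ∅)) * h γ) ≤ 0) :
    ∀ {F : Finset (Sym2 V)} {u v : V} {N A C : Finset (Sym2 V)} {y z : Sym2 V}, F.card ≤ n → IsTTSP F u v →
    s(u, v) ∉ F → N ⊆ F → A ⊆ F → C ⊆ A → y ∈ F → z ∈ F → y ≠ z → y ∉ N → z ∉ N → y ∉ A → z ∉ A → Disjoint N A →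
    ∀ w : ℕ → ℝ, (∀ k : ℕ, w (k + 1) ≤ w k) →
    ∀ h : Finset (Sym2 V) → ℝ, (∀ ⦃X Y : Finset (Sym2 V)⦄, X ⊆ Y → Y ⊆ N → h X ≤ h Y) →
      ∑ γ ∈ N.powerset,
        ((w (clusterCount (↑(insert s(u, v) (γ ∪ insert y (insert z A))) : BondConfig V) ∅ +
              clusterCount (↑(insert s(u, v) (N \ γ ∪ C)) : BondConfig V) ∅) -
          w (clusterCount (↑(insert s(u, v) (N \ γ ∪ insert y (insert z A))) : BondConfig V) ∅ +
              clusterCount (↑(insert s(u, v) (γ ∪ C)) : BondConfig V) ∅)) * h γ) +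
      ∑ γ ∈ N.powerset,
        ((w (clusterCount (↑(insert s(u, v) (γ ∪ insert z A)) : BondConfig V) ∅ +
              clusterCount (↑(insert s(u, v) (N \ γ ∪ insert y C)) : BondConfig V) ∅) -
          w (clusterCount (↑(insert s(u, v) (N \ γ ∪ insert z A)) : BondConfig V) ∅ +
              clusterCount (↑(insert s(u, v) (γ ∪ insert y C)) : BondConfig V) ∅)) * h γ) +
      ∑ γ ∈ N.powerset,
        ((w (clusterCount (↑(insert s(u, v) (γ ∪ insert y A)) : BondConfig V) ∅ +
              clusterCount (↑(insert s(u, v) (N \ γ ∪ insert z C)) : BondConfig V) ∅) -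
          w (clusterCount (↑(insert s(u, v) (N \ γ ∪ insert y A)) : BondConfig V) ∅ +
              clusterCount (↑(insert s(u, v) (γ ∪ insert z C)) : BondConfig V) ∅)) * h γ) ≤ 0 := by
  intro F u v N A C y z hF hFT huv hN hA hCA hy hz hyz hyN hzN hyA hzA hNA w hw h hm
  have con := orAttT_rootless_of_ih ih hF hFT hN (A := insert s(u, v) A) (C := insert s(u, v) C)
    (Finset.insert_subset_insert _ hA) (Finset.insert_subset_insert _ hCA)
    (Finset.mem_insert_of_mem hy) (Finset.mem_insert_of_mem hz) hyz hyN hzN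
    (by rw [Finset.mem_insert, not_or]; exact ⟨fun hh => huv (hh ▸ hy), hyA⟩)
    (by rw [Finset.mem_insert, not_or]; exact ⟨fun hh => huv (hh ▸ hz), hzA⟩)
    (Finset.disjoint_insert_right.2 ⟨fun hh => huv (hN hh), hNA⟩) w hw h hm
  have e1 : ∀ X : Finset (Sym2 V), X ∪ insert y (insert z (insert s(u, v) A)) = insert s(u, v) (X ∪ insert y (insert z A)) :=
    fun X => by simp only [Finset.union_insert]; rw [Finset.insert_comm (s(u, v)) y, Finset.insert_comm (s(u, v)) z]
  have e2 : ∀ X : Finset (Sym2 V), X ∪ insert z (insert s(u, v) A) = insert s(u, v) (X ∪ insert z A) := fun X => by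
    simp only [Finset.union_insert]; exact Finset.insert_comm _ _ _
  have e3 : ∀ X : Finset (Sym2 V), X ∪ insert y (insert s(u, v) A) = insert s(u, v) (X ∪ insert y A) := fun X => by
    simp only [Finset.union_insert]; exact Finset.insert_comm _ _ _
  have e4 : ∀ X : Finset (Sym2 V), X ∪ insert s(u, v) C = insert s(u, v) (X ∪ C) := fun X => Finset.union_insert _ _ _
  have e5 : ∀ X : Finset (Sym2 V), X ∪ insert y (insert s(u, v) C) = insert s(u, v) (X ∪ insert y C) := fun X => by
    simp only [Finset.union_insert]; exact Finset.insert_comm _ _ _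
  have e6 : ∀ X : Finset (Sym2 V), X ∪ insert z (insert s(u, v) C) = insert s(u, v) (X ∪ insert z C) := fun X => by
    simp only [Finset.union_insert]; exact Finset.insert_comm _ _ _
  simp_rw [e1, e2, e3, e4, e5, e6] at con
  exact con

end OrAttTStep

end FK

end Summit.CriticalPhenomena.PercolationContinuityZ3.Theorems

end
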